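import Summits.HodgeConjecture.CorCM.GaloisNonNormalPrimeOrder
import Mathlib.GroupTheory.SpecificGroups.Dihedral
import Mathlib.GroupTheory.SpecificGroups.Alternating
import HarnessLib

/-!
# `S₃ × H` (`|H| ≥ 8`) and `A₄ × H` (`|H| ≥ 4`) are BAD for EVERY complex conjugation — instances of the involution criteria of
# `CorCM/GaloisNonNormalPrimeOrder` (three conjugates at order `48`; any non-central involution from order `52`)

COR-CM (cell `pub-hodgecm2`), binder seat b04 (gen 33), count-neutral own lane «Galois-CM-type classification».  KERNEL ONLY:
theorems; no definition, no named fact, no `sorry`.  `HC_CM` is neither used nor claimed.  A reflection of `S₃` has three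
conjugates, a double transposition of `A₄` has three conjugates; so in `S₃ × H` resp. `A₄ × H` the element `(u, 1)` is a non-central
involution with `≥ 3` conjugates, and gen 33's `exists_simple_degenerate_of_involution_three_conjugates` (order `48`) resp.
`exists_simple_degenerate_of_noncentral_involution_of_card_ge` (order `≥ 52`) applies — for EVERY complex conjugation (it is never
located; it lies in `1 × Z(H)`).

* `exists_simple_degenerate_of_mulEquiv_dihedral_three_prod` — **`Gal(K/ℚ) ≅ S₃ × H`, `|H| ≥ 8` ⟹ a simple DEGENERATE abelian variety
  of dimension `3|H|` with CM by `K`.**  This RESOLVES the `S₃`-exception of gen 24's real-factor theorem (`K = M·L`, `M` a totally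
  real `S₃`-field: «the answer depends on `L`») for every CM factor of degree `≥ 8`: together with `S₃ × C₂ = D₆` GOOD (gen 14),
  `S₃ × C₄` BAD (gen 32), `S₃ × C₆` BAD (gen 30) only `S₃ × C₂²` (order `24`; BAD by the seat's census, no skew section of this shape —
  `0/64`) is left without a tree theorem.  New theorem-level rows: `S₃ × C₈`, `S₃ × Q₈`, `S₃ × D₄`, `S₃ × C₂ × C₄`, ….
* `exists_simple_degenerate_of_mulEquiv_alternating_four_prod_of_four_le` — **`Gal(K/ℚ) ≅ A₄ × H`, `|H| ≥ 4` ⟹ a simple DEGENERATE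
  abelian variety of dimension `6|H|`** (order `48`: three conjugates; `≥ 60`: the involution count) — uniform in `H` and `c`
  (`A₄ × C₄` also has the explicit certificate `CorCM/GaloisAlternatingFourTimesCyclicFourDegenerate`; `A₄ × C₂` is BAD by gen 19).

## References

* [Shimura1998] G. Shimura, *Abelian Varieties with Complex Multiplication and Modular Functions*, §6.2 Thm. 3, §8.2 Prop. 26, §32.10.
* [Gordon1999HodgeAVSurvey] B. B. Gordon, *A survey of the Hodge conjecture for abelian varieties*, Thm. 6.4, §9.3.
-/

noncomputable section

open CategoryTheory CategoryTheory.Limits NumberField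
open scoped BigOperators

namespace Summit.HodgeConjecture.CorCM.GaloisModels

open Literature.NumberTheory.ComplexMultiplication
open Literature.AlgebraicGeometry.Motives (AbelianVariety CMType)
open Literature.AlgebraicGeometry.HodgeTheory
open Literature.AlgebraicGeometry.ComplexMultiplication (IsCMTypeRealisation)
open Literature.AlgebraicGeometry.Pohlmann1968
open Literature.Barriers.HodgeConjecture (divisorClassesSpan)
open Summit.HodgeConjecture.CorCM.GaloisRank

variable {K : Type} [Field K] [NumberField K] [IsCMField K] [IsGalois ℚ K]

/-- In a product `F × H`, the three-conjugates data for `u ∈ F` lift to `(u, 1), (g₁, 1), (g₂, 1)`. [folklore] -/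
theorem three_conjugates_prod {F H : Type*} [Group F] [Group H] {u g₁ g₂ : F} (huu : u * u = 1) (h1 : g₁⁻¹ * u * g₁ ≠ u)
    (h2 : g₂⁻¹ * u * g₂ ≠ u) (h12 : g₂⁻¹ * g₁ * u * (g₂⁻¹ * g₁)⁻¹ ≠ u) :
    ((u, (1 : H)) : F × H) * (u, 1) = 1 ∧ ((g₁, (1 : H)) : F × H)⁻¹ * (u, 1) * (g₁, 1) ≠ (u, 1) ∧
      ((g₂, (1 : H)) : F × H)⁻¹ * (u, 1) * (g₂, 1) ≠ (u, 1) ∧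
      ((g₂, (1 : H)) : F × H)⁻¹ * (g₁, 1) * (u, 1) * (((g₂, (1 : H)) : F × H)⁻¹ * (g₁, 1))⁻¹ ≠ (u, 1) := by
  refine ⟨?_, ?_, ?_, ?_⟩
  · rw [Prod.mk_mul_mk, huu, mul_one]; rfl
  · intro h; exact h1 (by simpa using congrArg Prod.fst h)
  · intro h; exact h2 (by simpa using congrArg Prod.fst h)
  · intro h; exact h12 (by simpa using congrArg Prod.fst h)

/-- In a product `F × H`, a non-commuting pair in `F` lifts. [folklore] -/
theorem noncomm_prod {F H : Type*} [Group F] [Group H] {u g : F} (huu : u * u = 1) (hg : g * u ≠ u * g) :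
    ((u, (1 : H)) : F × H) * (u, 1) = 1 ∧ ∃ x : F × H, x * (u, 1) ≠ (u, 1) * x := by
  refine ⟨by rw [Prod.mk_mul_mk, huu, mul_one]; rfl, (g, 1), fun h => hg (by simpa using congrArg Prod.fst h)⟩

/-- `S₃ = DihedralGroup 3`: a reflection is an involution with three conjugates (data for both criteria). [folklore] -/
theorem dihedral_three_reflection_data :
    ∃ u g₁ g₂ : DihedralGroup 3, u * u = 1 ∧ g₁ * u ≠ u * g₁ ∧ g₁⁻¹ * u * g₁ ≠ u ∧ g₂⁻¹ * u * g₂ ≠ u ∧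
      g₂⁻¹ * g₁ * u * (g₂⁻¹ * g₁)⁻¹ ≠ u := by
  decide

/-- `A₄ = alternatingGroup (Fin 4)`: a double transposition is an involution with three conjugates, and `|A₄| = 12`. [folklore] -/
theorem alternating_four_involution_data :
    (∃ u g₁ g₂ : alternatingGroup (Fin 4), u * u = 1 ∧ g₁ * u ≠ u * g₁ ∧ g₁⁻¹ * u * g₁ ≠ u ∧ g₂⁻¹ * u * g₂ ≠ u ∧
      g₂⁻¹ * g₁ * u * (g₂⁻¹ * g₁)⁻¹ ≠ u) ∧ Fintype.card (alternatingGroup (Fin 4)) = 12 := by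
  refine ⟨by decide +kernel, ?_⟩
  have h := two_mul_card_alternatingGroup (α := Fin 4)
  rw [Fintype.card_perm, Fintype.card_fin, show Nat.factorial 4 = 24 from rfl] at h
  omega

/-- **`Gal(K/ℚ) ≅ S₃ × H` with `|H| ≥ 8` (ANY finite group `H`, ANY complex conjugation): a simple DEGENERATE abelian variety of
dimension `3|H|` with CM by `K`** and an exceptional Hodge class on some power.  Resolves gen 24's `S₃`-exception for CM factors of
degree `≥ 8` (`S₃ × C₈`, `S₃ × Q₈`, `S₃ × D₄`, …). [cite: Shimura1998, §6.2 Thm. 3, §8.2 Prop. 26 and §32.10]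
[cite: Gordon1999HodgeAVSurvey, Thm. 6.4 and §9.3] -/
theorem exists_simple_degenerate_of_mulEquiv_dihedral_three_prod {H : Type*} [Group H] [Fintype H] [DecidableEq H]
    (hH : 8 ≤ Fintype.card H) (e : (K ≃ₐ[ℚ] K) ≃* DihedralGroup 3 × H) :
    ∃ (Φ : CMType K) (φ₀ : K →+* ℂ) (A : AbelianVariety ℂ) (ι : 𝓞 K →+* End A)
      (θ : K →+* Module.End ℂ (complexBetti A.X 1)),
      IsPrimitive (ℂ ≃+* ℂ) Φ.1 φ₀ ∧ ¬ IsNondegenerate Φ ∧ IsCMTypeRealisation Φ A ι θ ∧ A.IsSimple ∧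
      A.dim = 3 * Fintype.card H ∧
      ∃ n p : ℕ, ∃ x : complexBetti (⨁ fun _ : Fin n => A).X (2 * p), IsRationalClass x ∧
        IsOfHodgeType (⨁ fun _ : Fin n => A).dim (⨁ fun _ : Fin n => A).X (2 * p) p p x ∧
        x ∉ divisorClassesSpan (⨁ fun _ : Fin n => A).X (⨁ fun _ : Fin n => A).dim p := by
  classical
  obtain ⟨u, g₁, g₂, huu, hnc, h1, h2, h12⟩ := dihedral_three_reflection_data
  have hcard : Fintype.card (DihedralGroup 3 × H) = 6 * Fintype.card H := by
    rw [Fintype.card_prod, DihedralGroup.card]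
  by_cases h8 : Fintype.card H = 8
  · obtain ⟨huu', h1', h2', h12'⟩ := three_conjugates_prod (H := H) huu h1 h2 h12
    obtain ⟨Φ, φ₀, A, ι, θ, H1, H2, H3, H4, H5, H6⟩ := exists_simple_degenerate_of_involution_three_conjugates e
      _ _ _ huu' h1' h2' h12' (by rw [hcard, h8])
    exact ⟨Φ, φ₀, A, ι, θ, H1, H2, H3, H4, by rw [H5, h8], H6⟩
  · obtain ⟨huu', hnc'⟩ := noncomm_prod (H := H) huu hnc
    obtain ⟨Φ, φ₀, A, ι, θ, H1, H2, H3, H4, H5, H6⟩ := exists_simple_degenerate_of_noncentral_involution_of_card_ge e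
      _ huu' hnc' (by rw [hcard]; omega)
    exact ⟨Φ, φ₀, A, ι, θ, H1, H2, H3, H4, by rw [H5, hcard]; omega, H6⟩

/-- **`Gal(K/ℚ) ≅ A₄ × H` with `|H| ≥ 4` (ANY finite group `H`, ANY complex conjugation): a simple DEGENERATE abelian variety of
dimension `6|H|` with CM by `K`** and an exceptional Hodge class on some power (`|H| = 4`: three conjugates at order `48`; `|H| ≥ 5`:
the involution count from order `60`). [cite: Shimura1998, §6.2 Thm. 3, §8.2 Prop. 26 and §32.10]
[cite: Gordon1999HodgeAVSurvey, Thm. 6.4 and §9.3] -/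
theorem exists_simple_degenerate_of_mulEquiv_alternating_four_prod_of_four_le {H : Type*} [Group H] [Fintype H]
    [DecidableEq H] (hH : 4 ≤ Fintype.card H) (e : (K ≃ₐ[ℚ] K) ≃* alternatingGroup (Fin 4) × H) :
    ∃ (Φ : CMType K) (φ₀ : K →+* ℂ) (A : AbelianVariety ℂ) (ι : 𝓞 K →+* End A)
      (θ : K →+* Module.End ℂ (complexBetti A.X 1)),
      IsPrimitive (ℂ ≃+* ℂ) Φ.1 φ₀ ∧ ¬ IsNondegenerate Φ ∧ IsCMTypeRealisation Φ A ι θ ∧ A.IsSimple ∧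
      A.dim = 6 * Fintype.card H ∧
      ∃ n p : ℕ, ∃ x : complexBetti (⨁ fun _ : Fin n => A).X (2 * p), IsRationalClass x ∧
        IsOfHodgeType (⨁ fun _ : Fin n => A).dim (⨁ fun _ : Fin n => A).X (2 * p) p p x ∧
        x ∉ divisorClassesSpan (⨁ fun _ : Fin n => A).X (⨁ fun _ : Fin n => A).dim p := by
  classical
  obtain ⟨⟨u, g₁, g₂, huu, hnc, h1, h2, h12⟩, hA⟩ := alternating_four_involution_data
  have hcard : Fintype.card (alternatingGroup (Fin 4) × H) = 12 * Fintype.card H := by rw [Fintype.card_prod, hA]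
  by_cases h4 : Fintype.card H = 4
  · obtain ⟨huu', h1', h2', h12'⟩ := three_conjugates_prod (H := H) huu h1 h2 h12
    obtain ⟨Φ, φ₀, A, ι, θ, H1, H2, H3, H4, H5, H6⟩ := exists_simple_degenerate_of_involution_three_conjugates e
      _ _ _ huu' h1' h2' h12' (by rw [hcard, h4])
    exact ⟨Φ, φ₀, A, ι, θ, H1, H2, H3, H4, by rw [H5, h4], H6⟩
  · obtain ⟨huu', hnc'⟩ := noncomm_prod (H := H) huu hnc
    obtain ⟨Φ, φ₀, A, ι, θ, H1, H2, H3, H4, H5, H6⟩ := exists_simple_degenerate_of_noncentral_involution_of_card_ge e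
      _ huu' hnc' (by rw [hcard]; omega)
    exact ⟨Φ, φ₀, A, ι, θ, H1, H2, H3, H4, by rw [H5, hcard]; omega, H6⟩

end Summit.HodgeConjecture.CorCM.GaloisModels

end
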